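import Mathlib
import HarnessLib
import Literature.Geometry.DiscreteGeometry.SphericalCodeHullEulerFormula

/-!
# Soft four-rings: counting over the hull complex (slack identity)

Support file for `SoftFourRings` (route `PricedLinkCensus`, sub-problem `Crystallization`).
Pure double counting over the facets (`facetNormals`), hull edges (`hullEdges`), facet sides
(`edgesOfFacet`) and the facets through an edge (`facetsOfEdge`) of a finite `X ⊂ S²` with
`0 ∈ interior (conv X)`, relative to a family `B ⊆ hullEdges X` of *bond* edges:

* `sum_card_nonbond_sides` — `Σ_f nb(f) = 2 · #(non-bond hull edges)`, where `nb(f)` is the number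
  of non-bond sides of the facet `f`;
* `sum_card_facets_containing` — `Σ_{v ∈ X} #{f ∈ S : v ∈ f} = Σ_{f ∈ S} #f`;
* `bondTriangles_slack_identity` — **the slack identity**: if `#B = 24` and `#F₃ + 40 = 2E`
  (twelve points, all facets triangles or quadrilaterals), then
  `T − 8 = Σ_{f not a bond triangle} (nb(f) − [f is a triangle])`, where `T` is the number of
  bond triangles (triangular facets with three bond sides).  In particular `T ≥ 8` once every
  non-bond triangle has a non-bond side.
-/

namespace Summit.AtomisticToContinuum.Crystallization.Theorems

open Real RealInnerProductSpace Literature.Geometry.DiscreteGeometry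

open scoped Classical in
/-- **`Σ_f nb(f) = 2x`**: summing over the facets the number of sides outside `B` counts every
hull edge outside `B` twice (every hull edge lies in exactly two facets). -/
theorem sum_card_nonbond_sides {X : Finset (EuclideanSpace ℝ (Fin 3))} (hX1 : ∀ y ∈ X, ‖y‖ = 1)
    (h0 : (0 : EuclideanSpace ℝ (Fin 3)) ∈
      interior (convexHull ℝ (X : Set (EuclideanSpace ℝ (Fin 3)))))
    (B : Finset (Finset (EuclideanSpace ℝ (Fin 3)))) :
    ∑ c ∈ facetNormals X, ((edgesOfFacet X c).filter (fun T => T ∉ B)).card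
      = 2 * ((hullEdges X).filter (fun T => T ∉ B)).card := by
  calc ∑ c ∈ facetNormals X, ((edgesOfFacet X c).filter (fun T => T ∉ B)).card
      = ∑ c ∈ facetNormals X, ∑ T ∈ (edgesOfFacet X c).filter (fun T => T ∉ B), 1 := by simp
    _ = ∑ T ∈ (hullEdges X).filter (fun T => T ∉ B), ∑ c ∈ facetsOfEdge X T, 1 := by
        refine Finset.sum_comm' fun c T => ?_
        unfold edgesOfFacet facetsOfEdge
        simp only [Finset.mem_filter]
        tauto
    _ = ∑ T ∈ (hullEdges X).filter (fun T => T ∉ B), 2 :=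
        Finset.sum_congr rfl fun T hT => by
          rw [Finset.sum_const, smul_eq_mul, mul_one,
            card_facetsOfEdge hX1 h0 (Finset.mem_filter.1 hT).1]
    _ = 2 * ((hullEdges X).filter (fun T => T ∉ B)).card := by
        rw [Finset.sum_const, smul_eq_mul, mul_comm]

open scoped Classical in
/-- **Vertex–facet incidences**: `Σ_{v ∈ X} #{f ∈ S : v tight for f} = Σ_{f ∈ S} #(tight set)`
for any family `S` of functionals (tight sets are subsets of `X`). -/
theorem sum_card_facets_containing (X : Finset (EuclideanSpace ℝ (Fin 3)))
    (S : Finset (EuclideanSpace ℝ (Fin 3))) :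
    ∑ v ∈ X, (S.filter (fun c => v ∈ tightSet X c)).card = ∑ c ∈ S, (tightSet X c).card := by
  have h : ∀ v ∈ X, (S.filter (fun c => v ∈ tightSet X c)).card
      = ∑ c ∈ S, if v ∈ tightSet X c then 1 else 0 := fun v _ => by
    rw [Finset.card_filter]
  rw [Finset.sum_congr rfl h, Finset.sum_comm]
  refine Finset.sum_congr rfl fun c _ => ?_
  rw [← Finset.card_filter, Finset.filter_mem_eq_inter,
    Finset.inter_eq_right.2 (tightSet_subset X c)]

open scoped Classical in
/-- **Bond triangles count their vertices thrice**: with `t_v = #{bond triangles at v}`,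
`Σ_v t_v = 3 T`. (Stated for any family `S` of facets with three-point tight sets.) -/
theorem sum_card_triangles_containing (X : Finset (EuclideanSpace ℝ (Fin 3)))
    (S : Finset (EuclideanSpace ℝ (Fin 3))) (hS : ∀ c ∈ S, (tightSet X c).card = 3) :
    ∑ v ∈ X, (S.filter (fun c => v ∈ tightSet X c)).card = 3 * S.card := by
  rw [sum_card_facets_containing, Finset.sum_const_nat hS, mul_comm]

open scoped Classical in
/-- **The slack identity.**  Let `B ⊆ hullEdges X` with `#B = 24`, and suppose
`#F₃ + 40 = 2 · #hullEdges` (`F₃` = triangular facets; this is Euler's formula for twelve points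
whose facets are triangles and quadrilaterals, `hull_counts_of_twelve`).  Write
`nb(f) = #{sides of f outside B}` and call `f` a *bond triangle* if it is a triangle with
`nb(f) = 0`; let `T` be their number.  Then
`T − 8 = Σ_{f not a bond triangle} (nb(f) − [f is a triangle])`. -/
theorem bondTriangles_slack_identity {X : Finset (EuclideanSpace ℝ (Fin 3))}
    (hX1 : ∀ y ∈ X, ‖y‖ = 1)
    (h0 : (0 : EuclideanSpace ℝ (Fin 3)) ∈
      interior (convexHull ℝ (X : Set (EuclideanSpace ℝ (Fin 3)))))
    {B : Finset (Finset (EuclideanSpace ℝ (Fin 3)))} (hBH : B ⊆ hullEdges X) (hB24 : B.card = 24)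
    (hF3 : ((facetNormals X).filter (fun c => (tightSet X c).card = 3)).card + 40
      = 2 * (hullEdges X).card) :
    ((((facetNormals X).filter (fun c => (tightSet X c).card = 3 ∧
        ((edgesOfFacet X c).filter (fun T => T ∉ B)).card = 0)).card : ℤ)) - 8
      = ∑ c ∈ (facetNormals X).filter (fun c => ¬ ((tightSet X c).card = 3 ∧
          ((edgesOfFacet X c).filter (fun T => T ∉ B)).card = 0)),
        ((((edgesOfFacet X c).filter (fun T => T ∉ B)).card : ℤ)
          - if (tightSet X c).card = 3 then 1 else 0) := by
  -- abbreviations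
  set F := facetNormals X with hF
  set nb : EuclideanSpace ℝ (Fin 3) → ℕ :=
    fun c => ((edgesOfFacet X c).filter (fun T => T ∉ B)).card with hnb
  set bt : EuclideanSpace ℝ (Fin 3) → Prop := fun c => (tightSet X c).card = 3 ∧ nb c = 0 with hbt
  -- `x = E − 24`
  have hx : ((hullEdges X).filter (fun T => T ∉ B)).card + 24 = (hullEdges X).card := by
    rw [Finset.filter_not, Finset.filter_mem_eq_inter, Finset.inter_eq_right.2 hBH,
      Finset.card_sdiff_of_subset hBH, ← hB24]
    have := Finset.card_le_card hBH
    omega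
  -- `Σ_F nb = 2x`, and the bond triangles contribute `0`
  have hsum := sum_card_nonbond_sides hX1 h0 B
  rw [← Finset.sum_filter_add_sum_filter_not F bt] at hsum
  have hzero : ∑ c ∈ F.filter bt, nb c = 0 :=
    Finset.sum_eq_zero fun c hc => (Finset.mem_filter.1 hc).2.2
  -- the number of non-bond triangles
  have htri : ∑ c ∈ F.filter (fun c => ¬ bt c), (if (tightSet X c).card = 3 then (1 : ℤ) else 0)
      = (((F.filter (fun c => (tightSet X c).card = 3)).card : ℤ)) - (F.filter bt).card := by
    rw [Finset.sum_boole]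
    have hsplit := Finset.card_filter_add_card_filter_not
      (s := F.filter (fun c => (tightSet X c).card = 3)) bt
    have h1 : (F.filter (fun c => (tightSet X c).card = 3)).filter bt = F.filter bt := by
      ext c
      simp only [Finset.mem_filter]
      constructor
      · rintro ⟨⟨hc, -⟩, hb⟩; exact ⟨hc, hb⟩
      · rintro ⟨hc, hb⟩; exact ⟨⟨hc, hb.1⟩, hb⟩
    have h2 : (F.filter (fun c => (tightSet X c).card = 3)).filter (fun c => ¬ bt c)
        = (F.filter (fun c => ¬ bt c)).filter (fun c => (tightSet X c).card = 3) := by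
      ext c
      simp only [Finset.mem_filter]
      tauto
    rw [h1, h2] at hsplit
    linarith [(by exact_mod_cast hsplit :
      ((F.filter bt).card : ℤ) +
        (((F.filter (fun c => ¬ bt c)).filter (fun c => (tightSet X c).card = 3)).card : ℤ)
        = (F.filter (fun c => (tightSet X c).card = 3)).card)]
  rw [Finset.sum_sub_distrib, htri]
  have hsum' : ((∑ c ∈ F.filter (fun c => ¬ bt c), nb c : ℕ) : ℤ)
      = 2 * (((hullEdges X).filter (fun T => T ∉ B)).card : ℤ) := by
    rw [hzero, zero_add] at hsum
    exact_mod_cast hsum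
  push_cast at hsum'
  have hx' : ((((hullEdges X).filter (fun T => T ∉ B)).card : ℤ)) + 24 = (hullEdges X).card := by
    exact_mod_cast hx
  have hF3' : (((F.filter (fun c => (tightSet X c).card = 3)).card : ℤ)) + 40
      = 2 * ((hullEdges X).card : ℤ) := by exact_mod_cast hF3
  linarith

end Summit.AtomisticToContinuum.Crystallization.Theorems
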